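import Literature.NumberTheory.EllipticCurves.BSDRankZeroDensity
import Literature.NumberTheory.EllipticCurves.PAdicHeights
import Literature.NumberTheory.EllipticCurves.SelmerLocalRestrictionKernel
import Literature.NumberTheory.EllipticCurves.LeadingTermBSZSplitReductionProofs
import Literature.NumberTheory.EllipticCurves.VariableChangePoints
import Literature.NumberTheory.QuadraticForms.PadicSquares
import Mathlib.NumberTheory.Padics.PadicVal.Basic
import HarnessLib

/-!
# Bhargava–Skinner–Zhang §3.1: the pieces `S₀(5) ⊇ S₁'(5) ⊇ S₁(5)`, the Tate set `T₅`, the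
# slice `SP'_K`, Lemma 20's `W` and `Z = ker res₅` — as predicates on `(A, B)`

Definitions WITH BODIES and elementary theorems only: **no named fact is introduced** (D-0014 /
D-0026, debt `+0`). Source:

> M. Bhargava, C. Skinner, W. Zhang, *A majority of elliptic curves over `ℚ` satisfy the Birch
> and Swinnerton-Dyer conjecture*, arXiv:1407.1826v2 (2014), §3.1 "Setup and notation" (p. 8;
> held text `paper:arxiv-1407.1826` p0008 L15–L31), verbatim:
> "For any prime `p ≥ 5`, let `S₀(p)` be the set of elliptic curves `E_{A,B}` over `ℚ` such that:
> • `E_{A,B}` has good ordinary or multiplicative reduction at `p`;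
> let `S₁'(p)` be the subset of curves `E_{A,B} ∈ S₀(p)` also satisfying:
> • if `E_{A,B}` has multiplicative reduction at `p`, then `p ∤ ord_p(Δ(A,B))`,
> • if `E_{A,B}` has split multiplicative reduction at `p`, then `ord_p(𝓛(E_{A,B})) = 1`;
> and let `S₁(p)` be the subset of curves `E_{A,B} ∈ S₁'(p)` also satisfying:
> • `p ∤ ord_ℓ(Δ(A,B))` for all primes `ℓ ≡ ±1 (mod p)` such that `ord_ℓ(Δ(A,B)) > 0`.
> Then `S₀(p)` is the set of curves satisfying (a) of Theorem 5; `S₁'(p)` is contained in the set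
> of curves satisfying (a) and (e) of Theorem 9 (see Remark 11); and `S₁(p)` is contained in the
> set of curves satisfying (a), (c), and (e) of Theorem 9 (see Remark 7)."

and Lemma 17 (p. 8, p0008 L46–L61: at `p = 5` the condition of `S₀(5)` "amount[s] to `5 ∤ A`"),
Lemma 20 (p. 10, p0010 L20–L25: the two `100%` conditions "`E[p]` is an irreducible
`Gal(ℚ̄/ℚ)`-module; there exist at least two prime factors `ℓ ∣∣ N(E)`, `ℓ ≠ p`, such that `E[p]`
is ramified at `ℓ`"), Remark 7 (p. 5: for `ℓ ≥ 5`, `E_{A,B}[p]` ramified at `ℓ ∣∣ N` iff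
`p ∤ ord_ℓ(Δ(E_{A,B}))`), and the proof of Cor. 26 (pp. 10–13) as RE-ASSEMBLED in the tree's
theorem of record `Literature.NumberTheory.EllipticCurves.bsz_rankLeOne_cRank_of_pieces`
(`LeadingTermBSZResCellAssemblyProofs.lean`; the bundle `pub-bsdpct`'s Theorem A′): abstract
pieces `T = S₀(5) ∩ S₁'(5)`, `R = T₅` (the Tate-fifth-power set: split multiplicative at `5`,
`5 ∣ ord₅Δ`, `E(ℚ₅)[5] ≠ 0`), `P = SP'_K = (S₀(5) ∖ (S₁'(5) ∪ T₅)) ∩ {ord₅Δ ≤ K}`, the twist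
subfamilies `U ⊆ T`, `U₀ ⊆ R`, the side sets `S₁`, `W`, and the subgroups `Z(E) = ker res₅`.

## What this file does (item C0 of the cell book `cells/density/CONVERSION-QUEUE.md`)

It INSTANTIATES the abstract variables `S₀ T R P S₁ W : ℤ × ℤ → Prop` and `Z` of
`bsz_rankLeOne_cRank_of_pieces` by predicates on the pair `AB = (A, B)` of the height family
(`E_{A,B} : y² = x³ + Ax + B`, `shortWeierstrass AB`; throughout `Δ' := 4A³ + 27B²`, so that
`Δ(E_{A,B}) = -16·Δ'` and `ord_ℓ Δ(E_{A,B}) = ord_ℓ Δ'` for odd `ℓ`), in the ARITHMETIC currency of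
the printed §3.1 — letter for letter the hypotheses under which the tree's kernel glue for the
class-theorem binders is already stated:

* `Pieces.S₀ AB :⟺ 5 ∤ A` — `S₀(5)` by Lemma 17 (tree `bsz_lemma17_mem_S0_five_iff`; the binder
  `hA` of `bsz_h9_five_of_zhang_of_skinnerZhang` / `hA5` of `bsz_h5_multiplicative_five_of_thmA`).
* `Pieces.S₁' AB :⟺ S₀ AB ∧ (5 ∣ Δ' → 5 ∤ ord₅ Δ') ∧ (E_{A,B} split multiplicative at 5 →
  ∀ Tate parameter datum D, ord₅ 𝓛(D) = 1)` — `S₀(5) ∩ S₁'(5)` = the piece `T`; the two bullets ARE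
  the binders `hfin`, `hL` of `bsz_h9_five_of_zhang_of_skinnerZhang` (`LeadingTermBSZRankOneH9Proofs`):
  multiplicative at `5` is `5 ∣ Δ'` given `5 ∤ A` (tree
  `hasMultiplicativeReductionAtPrime_shortWeierstrass_iff_of_isInHeightFamily`), and
  `𝓛(E) = WeierstrassCurve.LInvariant D` for `D : TateParameterData E 5` (`PAdicHeights.lean`).
* `Pieces.S₁Cond AB :⟺ ∀ primes ℓ ≡ ±1 (mod 5), ord_ℓ Δ' > 0 → 5 ∤ ord_ℓ Δ'` — the bullet of
  `S₁(5)` (= binder `hc`, verbatim), and `Pieces.S₁ AB :⟺ S₁' AB ∧ S₁Cond AB` — `S₁(5)` as printed;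
  `S₁Cond_iff_of_ne_zero` converts to the spelling of `bsz_mu_diff_inter_le` (display (2), `hν`).
* `Pieces.LocallyTorsionFree AB :⟺ ∀ P ∈ E_{A,B}(ℚ_[5]), 5•P = O → P = O` — "`E(ℚ₅)[5] = 0`" in
  the `ℚ_[5]`-currency of `natCard_selmerGroup_shortWeierstrass_le_mul_of_forall_padic`
  (`SelmerBoundLocalTorsionTransportProofs.lean`; binder `hker`) and of
  `forall_nsmul_eq_zero_adicCompletion_iff_padic` (the `htors` input of A329's `hlocP`).
* `Pieces.T₅ AB :⟺ S₀ AB ∧ ¬ S₁' AB ∧ ¬ LocallyTorsionFree AB` — the piece `R`. Inside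
  `S₀(5) ∖ S₁'(5)` (multiplicative at `5` with `5 ∣ ord₅Δ'`, or split with `ord₅𝓛 ≠ 1`) the curves
  with `E(ℚ₅)[5] ≠ 0` are exactly the split ones with `5 ∣ ord₅Δ'` whose Tate parameter is a fifth
  power (`prime_torsion_ne_zero_iff_exists_pow_eq_tateParameter`, `TateParameterPrimeTorsion.lean`;
  non-split multiplicative curves have `E(ℚ₅)[5] = 0`) — the bundle's `T` ("Tate-fifth-power set",
  `μ(T₅) = 78125/3813476172`); that identification is a docstring here, not a clause, so that
  `T`, `R`, `P` partition `S₀ ∩ {ord₅Δ' ≤ K}` BY DEFINITION.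
* `Pieces.SP' K AB :⟺ S₀ AB ∧ ¬ S₁' AB ∧ LocallyTorsionFree AB ∧ ord₅ Δ' ≤ K` — the piece `P`
  (the bundle's `SP'_K`, `K ≥ 9`), on which `hker` holds by `natCard_selmerGroup_shortWeierstrass_le_mul_of_forall_padic`.
* `Pieces.W₅ AB :⟺ ρ̄_{E_{A,B},5} surjective ∧ ∃ primes ℓ₁ ≠ ℓ₂, both > 5, of multiplicative
  reduction of E_{A,B} with 5 ∤ ord_{ℓᵢ} Δ'` — Lemma 20's two `100%` properties in the form the
  glue consumes (binders `hsurj`, `hram₂` of `bsz_h9_five_of_zhang_of_skinnerZhang`; W. Zhang's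
  Thm. 1.4 needs (sur), which implies (irr) — tree
  `hasIrreducibleModPGaloisRep_of_hasSurjectiveModNGaloisRep`; non-CM, needed by Kim's theorem on
  `P`, follows from either clause — tree `not_hasCM_of_hasSurjectiveModNGaloisRep_of_five_le`,
  `not_hasCM_of_hasMultiplicativeReductionAtPrime'` — and is not a clause).
* `Pieces.Z v AB := (shortWeierstrass AB).selmerResKer 5 ℚ_v` for the place `v ∋ 5`
  (`SelmerLocalRestrictionKernel.lean`, Bhargava–Skinner's `ker res₅`).

and proves: the six STRUCTURAL binders `hTS₀ hRS₀ hRT hPS₀ hPT hPR` of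
`bsz_rankLeOne_cRank_of_pieces` (one line each) and the partition
`S₀ ∧ ord₅Δ' ≤ K → T ∨ R ∨ P` (`Pieces.trichotomy`); the projections of `S₁'` / `S₁` / `W₅` onto
the glue's binders (`S₁'.not_dvd`, `.hfin`, `.hL`, `S₁.cond`, `W₅.surjective`, `.two_ramified`,
`.one_ramified`); and the stability of `S₀`, `S₁Cond`, `S₁'`, `S₁` under the twist by `-1`,
`negB : (A, B) ↦ (A, -B)` (for `S₁'`'s `𝓛`-clause: `j(E_{A,-B}) = j(E_{A,B})` and split
multiplicative reduction at `5` is the residue condition `A ≡ 3, B ≡ ±1 (mod 5)`, symmetric in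
`±B` — tree `hasSplitMultiplicativeReductionAtPrime_five_shortWeierstrass_iff` — so a Tate
parameter datum of `E_{A,-B}` at `5` is one of `E_{A,B}` with the same `q`, `Pieces.tateParameterData_negB`),
which is the hypothesis "`S₁(5)` is stable under `-1`-twist" of the proof of Cor. 26 (p0011 L84–85).

## What this file does NOT do, and the one seam it leaves (said once, here)

* No class theorem: the binders `h5` / `h9` / `hker` / `hWtors` ON THESE PIECES are the sibling
  `PiecesClassTheoremsProofs.lean` (theorems only, from the landed legs p373565 / p374010 /
  p374374 / p374181 / p369097 below named facts).
* No density (`hT hR hPd hν hW hκU hκU₀ h13T h13U₀ hlocP`: group (B), the bundle's task (c)).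
  Those counts, and the root-number subfamilies `U ⊆ T`, `U₀ ⊆ R` of Thm. 16
  (`thm16_exists_rootNumber_twist_subfamily_of_twistStable.exists_subfamily`, which wants a clopen
  `CongruenceFamily`), need the CONGRUENCE presentation of the pieces (§3.2 of the source: the sets
  `Σ₅^g`, `Σ₅^ns`, `Σ₅^spl`; the bundle's fifth-power table), i.e. the two identifications
  (i) "split, `5 ∤ k = ord₅Δ'`: `ord₅𝓛 = 1 ⟺` a residue condition on `(A, B) mod 5^{k+2}`"
  (proof of Lemma 18, displays (9)–(10), p0008 L104 – p0009 L21) and (ii) "split, `5 ∣ k`: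
  `E(ℚ₅)[5] ≠ 0 ⟺ q_E ∈ (ℚ₅)⁵ ⟺` a residue condition mod `5^{k+2}`" (bundle Lemma 4.3), whose
  proofs rest on the `q`-expansion `1/j(q) = q - 744q² + O(q³)` of the Tate curve and the
  valuation of the Iwasawa logarithm on `1 + 5ℤ₅` — NOT in the tree WHEN THIS FILE LANDED
  (08:51Z 2026-08-24; ERRATUM E-G123-8, docstring-only, 2026-08-24: the seam has since been CLOSED
  in the tree, theorems only — `valuation_tateJ` is discharged (`valuation_tateJ_holds`,
  `PAdicHeightsProofs`); `TateJSecondOrderProofs` gives the second-order control of `1/j(q)` and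
  `sq_dvd_tateUnit_pow_sub_one_iff` / `toZModPow_two_tateUnit_eq`; `PadicLogNormProofs` gives
  `‖log_p x‖ = ‖u^{p−1} − 1‖` (`norm_padicLog_eq_norm_unitPart_pow_sub_one`); identification (ii)
  is `PadicPthPowerCriterionProofs` (`exists_pow_prime_eq_iff` : `q ∈ (ℚ_pˣ)ᵖ ⟺ …`); the residue
  presentation of the `𝓛`-clause (i) with its densities is `LeadingTermBSZSplitOrdDensityProofs`
  (`tateUnitResidue`, `hasHeightDensity_sigma_spl_five`, `hasHeightDensity_SPprime_residues_five`);
  and the criteria ON THESE PIECES are the sibling `PiecesFiveAdicCriteriaProofs` (p378313)).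
  This WAS the one seam between the arithmetic pieces here and group (B): "`T = T_cong`,
  `R = R_cong` up to the tail `ord₅Δ' > K`". Two
  remarks for whoever closes it: (1) `T` and `R` as printed are not clopen `5`-adically
  (`k = ord₅Δ'` is unbounded), so Thm. 16 applies to truncations `T_K := T ∧ ord₅Δ' ≤ K`,
  `R_K` (defined below as `Pieces.S₁'Trunc K` / `Pieces.T₅Trunc K`, with the projections
  `S₁'Trunc.s₁'`, `T₅Trunc.t₅` and the `-1`-twist stabilities `S₁'Trunc.negB`, `T₅Trunc_negB_iff`;
  the `negB` transport API is `S₀_negB_iff`, `S₁Cond_negB_iff`, `j_shortWeierstrass_negB`,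
  `hasSplitMultiplicativeReductionAtPrime_five_negB_iff`, `tateParameterData_negB` /
  `lInvariant_tateParameterData_negB`, `S₁'_negB_iff`, `exists_sq_eq_neg_one_padic_five`,
  `smul_baseChange_shortWeierstrass_eq_negB`, `locallyTorsionFree_negB_iff`, `T₅_negB_iff`,
  `SP'_negB_iff` — named here because the Contents above did not list them, E-G123-8) and the
  final assembly goes through
  `heightDensityGE_satisfiesBSDRankLeOne_of_resPieces` with the tail charged against the margin
  `9.1(6)·10⁻⁷` of `bsz_rankLeOne_cRank_of_pieces`; (2) the source's sentence
  "`Δ(E_{A,B}) = Δ(q) = q - 24q² + ⋯`" (p0009 L3–L7) identifies the discriminant of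
  `y² = x³ + Ax + B` with the Tate curve's, whereas `Δ(E_{A,B}) = u¹²Δ(q)` with `u ∈ ℤ₅ˣ`,
  `u⁴ = -48A/E₄(q)`; the printed residue set `S_k` is therefore to be read through the model-free
  `1/j = Δ'/(6912A³)` rather than `Δ(A,B)` — the COUNT of Lemma 18 (as corrected in the tree,
  `bsz_lemma18_card_residues_eq_five`) and hence every density is unaffected.

Names are PROPOSALS of the interim writer (cell `b2b-bsdres`, row `eisenstein-p2`, serving the
cell lead's WAKE `C0-pieces`); the bundle `pub-bsdpct` may bridge or rename. HONEST FRAMING: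
bookkeeping definitions for a density count assembled from published theorems and labelled
preprint claims; nothing is booked, no density number, RESIDUAL-MAP mark, tier or status word
moves by this file; this is not "finishing BSD".

## References

* [BhargavaSkinnerZhang2014] M. Bhargava, C. Skinner, W. Zhang, arXiv:1407.1826v2 (2014): §3.1
  (p. 8), Lemma 17, Lemma 18 and its proof (pp. 8–9), Lemma 20 (p. 10), Rem. 7 and Rem. 11 (p. 5),
  proof of Cor. 26 (pp. 10–13).
* [BhargavaSkinner2014] M. Bhargava, C. Skinner, J. Ramanujan Math. Soc. 29 (2014) 221–242
  (arXiv:1401.0233): Thm. 7 (ii) and the proof of Lemma 16 (`Z = ker res₅`).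
* [MazurTateTeitelbaum1986Invent] B. Mazur, J. Tate, J. Teitelbaum, Invent. Math. 84 (1986),
  §II.1 (the `𝓛`-invariant).
-/

set_option autoImplicit false

noncomputable section

open scoped Classical

open WeierstrassCurve NumberField IsDedekindDomain

namespace Literature.NumberTheory.EllipticCurves.BhargavaSkinnerZhang2014

namespace Pieces

/-! ### The pieces -/

/-- **`S₀(5)`** (BSZ §3.1 with Lemma 17): "`E_{A,B}` has good ordinary or multiplicative
reduction at `5`", which for the curves `E_{A,B}` "amount[s] to `5 ∤ A`" (proof of Lemma 17,
p. 8; tree `bsz_lemma17_mem_S0_five_iff`). The piece `S₀` of `bsz_rankLeOne_cRank_of_pieces` and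
the binder `hA` / `hA5` of the `h9` / `h5` glue. [cite: BhargavaSkinnerZhang2014, §3.1 and Lemma 17 (p. 8)] -/
def S₀ (AB : ℤ × ℤ) : Prop :=
  ¬ (5 : ℤ) ∣ AB.1

/-- **`S₀(5) ∩ S₁'(5)`** (BSZ §3.1, p. 8), the piece `T`: `5 ∤ A`, and
"if `E_{A,B}` has multiplicative reduction at `5`, then `5 ∤ ord₅(Δ(A,B))`" — multiplicative at
`5` being `5 ∣ 4A³ + 27B²` given `5 ∤ A`, and `ord₅ Δ(A,B) = ord₅(4A³ + 27B²)` — and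
"if `E_{A,B}` has split multiplicative reduction at `5`, then `ord₅(𝓛(E_{A,B})) = 1`"
(`𝓛 = WeierstrassCurve.LInvariant D` for a Tate parameter datum `D`; the clause is vacuous unless
`E_{A,B}` is elliptic and split multiplicative at `5`). The second and third conjuncts are, letter
for letter, the binders `hfin` and `hL` of `bsz_h9_five_of_zhang_of_skinnerZhang`.
[cite: BhargavaSkinnerZhang2014, §3.1 (p. 8) and Rem. 11 (p. 5)] -/
def S₁' (AB : ℤ × ℤ) : Prop :=
  S₀ AB ∧
    ((5 : ℤ) ∣ 4 * AB.1 ^ 3 + 27 * AB.2 ^ 2 →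
      ¬ 5 ∣ padicValInt 5 (4 * AB.1 ^ 3 + 27 * AB.2 ^ 2)) ∧
    (haveI : Fact (Nat.Prime 5) := ⟨Nat.prime_five⟩
     ∀ [(shortWeierstrass AB).IsElliptic],
      (shortWeierstrass AB).HasSplitMultiplicativeReductionAtPrime 5 →
        ∀ D : TateParameterData (shortWeierstrass AB) 5, (LInvariant D).valuation = 1)

/-- **The bullet of `S₁(5)`** (BSZ §3.1, p. 8): "`5 ∤ ord_ℓ(Δ(A,B))` for all primes
`ℓ ≡ ±1 (mod 5)` such that `ord_ℓ(Δ(A,B)) > 0`" (by Remark 7 this is hypothesis (c) of Thm. 9 for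
the curves `E_{A,B}`); letter for letter the binder `hc` of `bsz_h9_five_of_zhang_of_skinnerZhang`.
A condition at the primes `ℓ ≠ 5` only. [cite: BhargavaSkinnerZhang2014, §3.1 (p. 8) and Rem. 7 (p. 5)] -/
def S₁Cond (AB : ℤ × ℤ) : Prop :=
  ∀ (ℓ : ℕ) [Fact ℓ.Prime], ((ℓ : ZMod 5) = 1 ∨ (ℓ : ZMod 5) = -1) →
    0 < padicValInt ℓ (4 * AB.1 ^ 3 + 27 * AB.2 ^ 2) →
      ¬ 5 ∣ padicValInt ℓ (4 * AB.1 ^ 3 + 27 * AB.2 ^ 2)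

/-- **`S₀(5) ∩ S₁(5)`** (BSZ §3.1, p. 8): "the subset of curves `E_{A,B} ∈ S₁'(p)` also
satisfying" the bullet `S₁Cond`. In `bsz_rankLeOne_cRank_of_pieces` the slot `S₁` is intersected
with `T = S₁'` anyway (`h9` on `T ∩ S₁ ∩ W`, `hν` on `T ∖ S₁`), so either `S₁` or `S₁Cond` may be
passed there. [cite: BhargavaSkinnerZhang2014, §3.1 (p. 8)] -/
def S₁ (AB : ℤ × ℤ) : Prop :=
  S₁' AB ∧ S₁Cond AB

/-- **"`E_{A,B}(ℚ₅)[5] = 0`"** in the `ℚ_[5]`-currency of the tree's `hker` glue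
(`natCard_selmerGroup_shortWeierstrass_le_mul_of_forall_padic`): every `ℚ₅`-point of
`y² = x³ + Ax + B` killed by `5` is `O`. On the multiplicative-at-`5` curves this is the condition
separating the bundle's slice `SP'` (where it holds: its Lemma 4.3) from the Tate set `T₅`.
[cite: BhargavaSkinner2014, proof of Lemma 16] -/
def LocallyTorsionFree (AB : ℤ × ℤ) : Prop :=
  ∀ P : ((shortWeierstrass AB).baseChange ℚ_[5]).toAffine.Point, (5 : ℕ) • P = 0 → P = 0

/-- **The Tate-fifth-power set `T₅`**, the piece `R` of `bsz_rankLeOne_cRank_of_pieces` (proof of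
Cor. 26: the part of `S₀(5) ∖ S₁'(5)` "on which the above arguments have not been applied", run
through Thm. 21 only; the bundle `pub-bsdpct`'s `T`, `μ(T₅) = 78125/3813476172`): the curves of
`S₀(5) ∖ S₁'(5)` with `E(ℚ₅)[5] ≠ 0` — which are exactly the split multiplicative ones with
`5 ∣ ord₅Δ'` and Tate parameter a fifth power in `ℚ₅`
(`prime_torsion_ne_zero_iff_exists_pow_eq_tateParameter`; not restated as a clause).
[cite: BhargavaSkinnerZhang2014, proof of Cor. 26 (pp. 11–12)] -/
def T₅ (AB : ℤ × ℤ) : Prop :=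
  S₀ AB ∧ ¬ S₁' AB ∧ ¬ LocallyTorsionFree AB

/-- **The slice `SP'_K`**, the piece `P` of `bsz_rankLeOne_cRank_of_pieces`:
`(S₀(5) ∖ (S₁'(5) ∪ T₅)) ∩ {ord₅Δ' ≤ K}` — multiplicative at `5`, outside `S₁'(5)`, with
`E(ℚ₅)[5] = 0`, truncated at `ord₅(4A³ + 27B²) ≤ K` (`K ≥ 9` in the theorem of record) so that its
`5`-adic condition set is compact, as Bhargava–Skinner's count (`hlocP`) requires.
[cite: BhargavaSkinnerZhang2014, proof of Cor. 26 (pp. 11–12)] [cite: BhargavaSkinner2014, Thm 7 (ii) and Lemma 16] -/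
def SP' (K : ℕ) (AB : ℤ × ℤ) : Prop :=
  S₀ AB ∧ ¬ S₁' AB ∧ LocallyTorsionFree AB ∧ padicValInt 5 (4 * AB.1 ^ 3 + 27 * AB.2 ^ 2) ≤ K

/-- The truncation `T_K := (S₀(5) ∩ S₁'(5)) ∩ {ord₅(4A³ + 27B²) ≤ K}` — a clopen `5`-adic
condition once `S₁'` is given its congruence presentation; offered to the assembler of
`heightDensityGE_satisfiesBSDRankLeOne_of_resPieces` (module docstring, remark (1)).
[cite: BhargavaSkinnerZhang2014, §3.1–3.2 (pp. 8–9)] -/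
def S₁'Trunc (K : ℕ) (AB : ℤ × ℤ) : Prop :=
  S₁' AB ∧ padicValInt 5 (4 * AB.1 ^ 3 + 27 * AB.2 ^ 2) ≤ K

/-- The truncation `R_K := T₅ ∩ {ord₅(4A³ + 27B²) ≤ K}` (module docstring, remark (1)).
[cite: BhargavaSkinnerZhang2014, proof of Cor. 26 (pp. 11–12)] -/
def T₅Trunc (K : ℕ) (AB : ℤ × ℤ) : Prop :=
  T₅ AB ∧ padicValInt 5 (4 * AB.1 ^ 3 + 27 * AB.2 ^ 2) ≤ K

/-- **Lemma 20's `100%` set `W`** (BSZ p. 10: "`E[p]` is an irreducible `Gal(ℚ̄/ℚ)`-module;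
there exist at least two prime factors `ℓ ∣∣ N(E)`, `ℓ ≠ p`, such that `E[p]` is ramified at
`ℓ`"; its proof supplies "two primes `5 ≤ ℓ₁, ℓ₂ ≤ L`", and Remark 7 reads ramification at a
multiplicative `ℓ ≥ 5` of `E_{A,B}` as `p ∤ ord_ℓ(Δ(E_{A,B}))`), in the form the glue consumes at
`p = 5`: `ρ̄_{E_{A,B},5}` SURJECTIVE (W. Zhang's hypothesis, stronger than (irr) and also a `100%`
condition — Duke 1997) and two primes `ℓ₁ ≠ ℓ₂`, both `> 5`, of multiplicative reduction of
`E_{A,B}` with `5 ∤ ord_{ℓᵢ}(4A³ + 27B²)` — letter for letter the binders `hsurj`, `hram₂` of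
`bsz_h9_five_of_zhang_of_skinnerZhang`. [cite: BhargavaSkinnerZhang2014, Lemma 20 and its proof (p. 10), Rem. 7 (p. 5)] -/
def W₅ (AB : ℤ × ℤ) : Prop :=
  (shortWeierstrass AB).HasSurjectiveModNGaloisRep 5 ∧
    ∃ ℓ₁ ℓ₂ : ℕ, ∃ _ : Fact ℓ₁.Prime, ∃ _ : Fact ℓ₂.Prime, ℓ₁ ≠ ℓ₂ ∧ 5 < ℓ₁ ∧ 5 < ℓ₂ ∧
      (shortWeierstrass AB).HasMultiplicativeReductionAtPrime ℓ₁ ∧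
      (shortWeierstrass AB).HasMultiplicativeReductionAtPrime ℓ₂ ∧
      ¬ 5 ∣ padicValInt ℓ₁ (4 * AB.1 ^ 3 + 27 * AB.2 ^ 2) ∧
      ¬ 5 ∣ padicValInt ℓ₂ (4 * AB.1 ^ 3 + 27 * AB.2 ^ 2)

/-- **`Z(E_{A,B}) = ker (res₅ : Sel₅(E_{A,B}) → E_{A,B}(ℚ₅)/5E_{A,B}(ℚ₅))`** (Bhargava–Skinner
Thm. 7 (ii), proof of Lemma 16) at the place `v ∋ 5` of `ℚ`: the tree's
`WeierstrassCurve.selmerResKer` (`SelmerLocalRestrictionKernel.lean`), in the shape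
`(AB : ℤ × ℤ) → AddSubgroup (Sel₅(E_{A,B}))` of the variable `Z` of
`bsz_rankLeOne_cRank_of_pieces`. [cite: BhargavaSkinner2014, Thm 7 (ii) and proof of Lemma 16] -/
def Z (v : HeightOneSpectrum (𝓞 ℚ)) (AB : ℤ × ℤ) :
    AddSubgroup ((shortWeierstrass AB).selmerGroup 5) :=
  (shortWeierstrass AB).selmerResKer 5 (v.adicCompletion ℚ)

/-! ### The structural binders of `bsz_rankLeOne_cRank_of_pieces` -/

/-- `hTS₀`: `T ⊆ S₀`. [cite: BhargavaSkinnerZhang2014, §3.1 (p. 8)] -/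
theorem S₁'.s₀ {AB : ℤ × ℤ} (h : S₁' AB) : S₀ AB := h.1

/-- `hRS₀`: `R = T₅ ⊆ S₀`. [cite: BhargavaSkinnerZhang2014, proof of Cor. 26 (p. 11)] -/
theorem T₅.s₀ {AB : ℤ × ℤ} (h : T₅ AB) : S₀ AB := h.1

/-- `hRT`: `R = T₅` is disjoint from `T = S₁'`. [cite: BhargavaSkinnerZhang2014, proof of Cor. 26 (p. 11)] -/
theorem T₅.not_s₁' {AB : ℤ × ℤ} (h : T₅ AB) : ¬ S₁' AB := h.2.1

/-- `hPS₀`: `P = SP'_K ⊆ S₀`. [cite: BhargavaSkinnerZhang2014, proof of Cor. 26 (p. 11)] -/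
theorem SP'.s₀ {K : ℕ} {AB : ℤ × ℤ} (h : SP' K AB) : S₀ AB := h.1

/-- `hPT`: `P = SP'_K` is disjoint from `T = S₁'`. [cite: BhargavaSkinnerZhang2014, proof of Cor. 26 (p. 11)] -/
theorem SP'.not_s₁' {K : ℕ} {AB : ℤ × ℤ} (h : SP' K AB) : ¬ S₁' AB := h.2.1

/-- `hPR`: `P = SP'_K` is disjoint from `R = T₅` (the local `5`-torsion separates them).
[cite: BhargavaSkinnerZhang2014, proof of Cor. 26 (p. 11)] -/
theorem SP'.not_t₅ {K : ℕ} {AB : ℤ × ℤ} (h : SP' K AB) : ¬ T₅ AB := fun hR ↦ hR.2.2 h.2.2.1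

/-- `P = SP'_K` lies in the truncation `ord₅(4A³ + 27B²) ≤ K`. [cite: BhargavaSkinnerZhang2014, proof of Cor. 26 (p. 11)] -/
theorem SP'.padicValInt_le {K : ℕ} {AB : ℤ × ℤ} (h : SP' K AB) :
    padicValInt 5 (4 * AB.1 ^ 3 + 27 * AB.2 ^ 2) ≤ K := h.2.2.2

/-- On `P = SP'_K`, `E_{A,B}(ℚ₅)[5] = 0` — the local input of `hker`. [cite: BhargavaSkinner2014, proof of Lemma 16] -/
theorem SP'.locallyTorsionFree {K : ℕ} {AB : ℤ × ℤ} (h : SP' K AB) : LocallyTorsionFree AB :=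
  h.2.2.1

/-- **The three pieces partition `S₀(5) ∩ {ord₅Δ' ≤ K}`**: a curve of `S₀` with
`ord₅(4A³ + 27B²) ≤ K` lies in `T = S₁'`, or in `R = T₅`, or in `P = SP'_K` (by cases on `S₁'` and
on the local `5`-torsion); consistent with `μ(S₁'(5)) + μ(T₅) + μ(SP') = μ(S₀(5))`
(`bsz_resCell_partition_value`). [cite: BhargavaSkinnerZhang2014, proof of Cor. 26 (pp. 11–12)] -/
theorem trichotomy {K : ℕ} {AB : ℤ × ℤ} (h₀ : S₀ AB)
    (hK : padicValInt 5 (4 * AB.1 ^ 3 + 27 * AB.2 ^ 2) ≤ K) :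
    S₁' AB ∨ T₅ AB ∨ SP' K AB := by
  by_cases h₁ : S₁' AB
  · exact Or.inl h₁
  · by_cases ht : LocallyTorsionFree AB
    · exact Or.inr (Or.inr ⟨h₀, h₁, ht, hK⟩)
    · exact Or.inr (Or.inl ⟨h₀, h₁, ht⟩)

/-- The pieces are pairwise disjoint (the three exclusions in one statement).
[cite: BhargavaSkinnerZhang2014, proof of Cor. 26 (pp. 11–12)] -/
theorem pairwise_disjoint {K : ℕ} {AB : ℤ × ℤ} :
    (S₁' AB → ¬ T₅ AB) ∧ (S₁' AB → ¬ SP' K AB) ∧ (T₅ AB → ¬ SP' K AB) :=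
  ⟨fun h hR ↦ hR.not_s₁' h, fun h hP ↦ hP.not_s₁' h, fun hR hP ↦ hP.not_t₅ hR⟩

/-- The truncations sit inside their pieces. [cite: BhargavaSkinnerZhang2014, §3.1 (p. 8)] -/
theorem S₁'Trunc.s₁' {K : ℕ} {AB : ℤ × ℤ} (h : S₁'Trunc K AB) : S₁' AB := h.1

/-- The truncations sit inside their pieces. [cite: BhargavaSkinnerZhang2014, proof of Cor. 26 (p. 11)] -/
theorem T₅Trunc.t₅ {K : ℕ} {AB : ℤ × ℤ} (h : T₅Trunc K AB) : T₅ AB := h.1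

/-! ### The pieces project onto the binders of the landed glue -/

/-- `T ∋ E_{A,B}` gives `5 ∤ A` (binder `hA`). [cite: BhargavaSkinnerZhang2014, Lemma 17 (p. 8)] -/
theorem S₁'.not_dvd {AB : ℤ × ℤ} (h : S₁' AB) : ¬ (5 : ℤ) ∣ AB.1 := h.1

/-- `T ∋ E_{A,B}` gives the first bullet of `S₁'(5)` (binder `hfin`: "`E[5]` is not finite at `5`",
Remark 11). [cite: BhargavaSkinnerZhang2014, §3.1 (p. 8) and Rem. 11 (p. 5)] -/
theorem S₁'.hfin {AB : ℤ × ℤ} (h : S₁' AB) :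
    (5 : ℤ) ∣ 4 * AB.1 ^ 3 + 27 * AB.2 ^ 2 → ¬ 5 ∣ padicValInt 5 (4 * AB.1 ^ 3 + 27 * AB.2 ^ 2) :=
  h.2.1

/-- `T ∋ E_{A,B}` gives the second bullet of `S₁'(5)` (binder `hL`: `ord₅ 𝓛(E_{A,B}) = 1` at a
split multiplicative `5`), for any `Fact (Nat.Prime 5)` instance.
[cite: BhargavaSkinnerZhang2014, §3.1 (p. 8)] [cite: MazurTateTeitelbaum1986Invent, §II.1] -/
theorem S₁'.hL {AB : ℤ × ℤ} (h : S₁' AB) [Fact (Nat.Prime 5)] :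
    ∀ [(shortWeierstrass AB).IsElliptic],
      (shortWeierstrass AB).HasSplitMultiplicativeReductionAtPrime 5 →
        ∀ D : TateParameterData (shortWeierstrass AB) 5, (LInvariant D).valuation = 1 :=
  h.2.2

/-- Assembling `T ∋ E_{A,B}` from the three binders `hA`, `hfin`, `hL`.
[cite: BhargavaSkinnerZhang2014, §3.1 (p. 8)] -/
theorem S₁'.of_binders {AB : ℤ × ℤ} [Fact (Nat.Prime 5)] (hA : ¬ (5 : ℤ) ∣ AB.1)
    (hfin : (5 : ℤ) ∣ 4 * AB.1 ^ 3 + 27 * AB.2 ^ 2 →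
      ¬ 5 ∣ padicValInt 5 (4 * AB.1 ^ 3 + 27 * AB.2 ^ 2))
    (hL : ∀ [(shortWeierstrass AB).IsElliptic],
      (shortWeierstrass AB).HasSplitMultiplicativeReductionAtPrime 5 →
        ∀ D : TateParameterData (shortWeierstrass AB) 5, (LInvariant D).valuation = 1) :
    S₁' AB :=
  ⟨hA, hfin, hL⟩

/-- `S₁ ⊆ S₁' = T`. [cite: BhargavaSkinnerZhang2014, §3.1 (p. 8)] -/
theorem S₁.s₁' {AB : ℤ × ℤ} (h : S₁ AB) : S₁' AB := h.1

/-- `S₁ ∋ E_{A,B}` gives the bullet of `S₁(5)` (binder `hc`). [cite: BhargavaSkinnerZhang2014, §3.1 (p. 8)] -/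
theorem S₁.cond {AB : ℤ × ℤ} (h : S₁ AB) : S₁Cond AB := h.2

/-- For a prime `ℓ`: `ℓ ≡ ±1 (mod 5)` in the residue spelling `(ℓ : ZMod 5) = ±1` of the glue iff
in the remainder spelling `ℓ % 5 ∈ {1, 4}` of `bsz_mu_diff_inter_le`. [folklore] -/
private theorem natCast_zmod_five_eq_or_iff (ℓ : ℕ) :
    ((ℓ : ZMod 5) = 1 ∨ (ℓ : ZMod 5) = -1) ↔ (ℓ % 5 = 1 ∨ ℓ % 5 = 4) := by
  have h1 : ((ℓ : ZMod 5) = 1) ↔ ℓ % 5 = 1 := by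
    rw [show (1 : ZMod 5) = ((1 : ℕ) : ZMod 5) from Nat.cast_one.symm,
      ZMod.natCast_eq_natCast_iff', Nat.one_mod]
  have h4 : ((ℓ : ZMod 5) = -1) ↔ ℓ % 5 = 4 := by
    rw [show (-1 : ZMod 5) = ((4 : ℕ) : ZMod 5) from by decide, ZMod.natCast_eq_natCast_iff']
  rw [h1, h4]

/-- **The bullet of `S₁(5)` in the spelling of display (2)'s discharge.** For `4A³ + 27B² ≠ 0`
(every member of the height family), `S₁Cond AB` iff
`∀ ℓ prime, ℓ % 5 ∈ {1, 4} → ℓ ∣ 4A³ + 27B² → 5 ∤ ord_ℓ(4A³ + 27B²)` — the predicate negated inside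
`bsz_mu_diff_inter_le` (`LeadingTermBSZMuDiffProofs.lean`, the binder `hν`). (At `4A³ + 27B² = 0`
the two spellings differ: `ord_ℓ 0 = 0`.) [cite: BhargavaSkinnerZhang2014, §3.1 (p. 8) and display (2) (p. 10)] -/
theorem S₁Cond_iff_of_ne_zero {AB : ℤ × ℤ} (hΔ : 4 * AB.1 ^ 3 + 27 * AB.2 ^ 2 ≠ 0) :
    S₁Cond AB ↔
      ∀ ℓ : ℕ, ℓ.Prime → (ℓ % 5 = 1 ∨ ℓ % 5 = 4) → (ℓ : ℤ) ∣ 4 * AB.1 ^ 3 + 27 * AB.2 ^ 2 →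
        ¬ 5 ∣ padicValInt ℓ (4 * AB.1 ^ 3 + 27 * AB.2 ^ 2) := by
  have key : ∀ (ℓ : ℕ) [Fact ℓ.Prime],
      (0 < padicValInt ℓ (4 * AB.1 ^ 3 + 27 * AB.2 ^ 2) ↔
        (ℓ : ℤ) ∣ 4 * AB.1 ^ 3 + 27 * AB.2 ^ 2) := by
    intro ℓ _
    have h1 := padicValInt_dvd_iff (p := ℓ) 1 (4 * AB.1 ^ 3 + 27 * AB.2 ^ 2)
    rw [pow_one] at h1
    rw [h1]
    constructor
    · exact fun hpos ↦ Or.inr hpos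
    · rintro (h0 | hpos)
      · exact absurd h0 hΔ
      · exact hpos
  constructor
  · intro h ℓ hℓ hmod hdvd
    haveI : Fact ℓ.Prime := ⟨hℓ⟩
    exact h ℓ ((natCast_zmod_five_eq_or_iff ℓ).2 hmod) ((key ℓ).2 hdvd)
  · intro h ℓ iℓ hmod hpos
    exact h ℓ iℓ.out ((natCast_zmod_five_eq_or_iff ℓ).1 hmod) ((key ℓ).1 hpos)

/-- `W ∋ E_{A,B}` gives (sur) at `5` (binder `hsurj`). [cite: BhargavaSkinnerZhang2014, Lemma 20 (p. 10)] -/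
theorem W₅.surjective {AB : ℤ × ℤ} (h : W₅ AB) :
    (shortWeierstrass AB).HasSurjectiveModNGaloisRep 5 := h.1

/-- `W ∋ E_{A,B}` gives Lemma 20's two ramified multiplicative primes `ℓ₁ ≠ ℓ₂ > 5` (binder
`hram₂`). [cite: BhargavaSkinnerZhang2014, Lemma 20 and its proof (p. 10), Rem. 7 (p. 5)] -/
theorem W₅.two_ramified {AB : ℤ × ℤ} (h : W₅ AB) :
    ∃ ℓ₁ ℓ₂ : ℕ, ∃ _ : Fact ℓ₁.Prime, ∃ _ : Fact ℓ₂.Prime, ℓ₁ ≠ ℓ₂ ∧ 5 < ℓ₁ ∧ 5 < ℓ₂ ∧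
      (shortWeierstrass AB).HasMultiplicativeReductionAtPrime ℓ₁ ∧
      (shortWeierstrass AB).HasMultiplicativeReductionAtPrime ℓ₂ ∧
      ¬ 5 ∣ padicValInt ℓ₁ (4 * AB.1 ^ 3 + 27 * AB.2 ^ 2) ∧
      ¬ 5 ∣ padicValInt ℓ₂ (4 * AB.1 ^ 3 + 27 * AB.2 ^ 2) := h.2

/-- `W ∋ E_{A,B}` gives ONE ramified multiplicative prime `ℓ > 5` (the (ram) binder `hram` of
`bsz_h5_multiplicative_five_of_thmA`, Thm. 5 (c) in Remark 7's form).
[cite: BhargavaSkinnerZhang2014, Thm. 5 (c) and Rem. 7 (p. 5), Lemma 20 (p. 10)] -/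
theorem W₅.one_ramified {AB : ℤ × ℤ} (h : W₅ AB) :
    ∃ ℓ : ℕ, ∃ _ : Fact ℓ.Prime, 5 < ℓ ∧
      (shortWeierstrass AB).HasMultiplicativeReductionAtPrime ℓ ∧
      ¬ 5 ∣ padicValInt ℓ (4 * AB.1 ^ 3 + 27 * AB.2 ^ 2) := by
  obtain ⟨ℓ₁, -, i₁, -, -, h₁, -, hm₁, -, hr₁, -⟩ := h.2
  exact ⟨ℓ₁, i₁, h₁, hm₁, hr₁⟩

/-! ### Stability under the twist by `-1`, `negB : (A, B) ↦ (A, -B)` -/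

/-- `Δ'(A, -B) = Δ'(A, B)`: `4A³ + 27(-B)² = 4A³ + 27B²`. [folklore] -/
private theorem disc_negB (AB : ℤ × ℤ) :
    4 * (negB AB).1 ^ 3 + 27 * (negB AB).2 ^ 2 = 4 * AB.1 ^ 3 + 27 * AB.2 ^ 2 := by
  simp only [negB]; ring

/-- `S₀ (A, -B) ↔ S₀ (A, B)` (a condition on `A`). [cite: BhargavaSkinnerZhang2014, Lemma 17 (p. 8)] -/
theorem S₀_negB_iff (AB : ℤ × ℤ) : S₀ (negB AB) ↔ S₀ AB := by
  simp only [S₀, negB]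

/-- `S₀(5)` is stable under the twist by `-1`. [cite: BhargavaSkinnerZhang2014, Lemma 17 (p. 8)] -/
theorem S₀.negB {AB : ℤ × ℤ} (h : S₀ AB) : S₀ (EllipticCurves.negB AB) :=
  (S₀_negB_iff AB).2 h

/-- The bullet of `S₁(5)` is stable under the twist by `-1` (`Δ'` is even in `B`) — "`S₁(5)` is
stable under `-1`-twist" (proof of Cor. 26). [cite: BhargavaSkinnerZhang2014, proof of Cor. 26 (p. 11)] -/
theorem S₁Cond_negB_iff (AB : ℤ × ℤ) : S₁Cond (negB AB) ↔ S₁Cond AB := by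
  simp only [S₁Cond, disc_negB]

/-- `j(E_{A,-B}) = j(E_{A,B})` (`c₄ = -48A`, `Δ = -16(4A³ + 27B²)` are even in `B`).
[cite: BhargavaSkinnerZhang2014, proof of Cor. 26 (p. 11)] -/
theorem j_shortWeierstrass_negB {AB : ℤ × ℤ} (h : IsInHeightFamily AB) :
    haveI := isElliptic_shortWeierstrass ((isInHeightFamily_negB AB).2 h)
    haveI := isElliptic_shortWeierstrass h
    (shortWeierstrass (negB AB)).j = (shortWeierstrass AB).j := by
  haveI := isElliptic_shortWeierstrass ((isInHeightFamily_negB AB).2 h)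
  haveI := isElliptic_shortWeierstrass h
  have hc : (shortWeierstrass (negB AB)).c₄ = (shortWeierstrass AB).c₄ := by
    simp only [shortWeierstrass, negB, WeierstrassCurve.c₄, WeierstrassCurve.b₂,
      WeierstrassCurve.b₄]
  have hΔ : (shortWeierstrass (negB AB)).Δ = (shortWeierstrass AB).Δ := by
    simp only [shortWeierstrass, negB, WeierstrassCurve.Δ, WeierstrassCurve.b₂,
      WeierstrassCurve.b₄, WeierstrassCurve.b₆, WeierstrassCurve.b₈]
    push_cast
    ring
  simp only [WeierstrassCurve.j, hc, Units.val_inv_eq_inv_val, WeierstrassCurve.coe_Δ', hΔ]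

/-- In `ℤ/5ℤ`, `-x ∈ {1, 4} ↔ x ∈ {1, 4}` (the classes `B ≡ ±1 (mod 5)` are stable under
`B ↦ -B`). [folklore] -/
private theorem neg_eq_one_or_eq_four_iff (x : ZMod 5) : (-x = 1 ∨ -x = 4) ↔ (x = 1 ∨ x = 4) := by
  revert x; decide

/-- Split multiplicative reduction at `5` is stable under the twist by `-1` on the height family:
it is the residue condition `A ≡ 3`, `B ≡ ±1 (mod 5)` (proof of Lemma 18; tree
`hasSplitMultiplicativeReductionAtPrime_five_shortWeierstrass_iff`), symmetric in `±B` — as it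
must be, `-1` being a square in `ℚ₅`. [cite: BhargavaSkinnerZhang2014, Lemma 18 (proof, p. 8)] -/
theorem hasSplitMultiplicativeReductionAtPrime_five_negB_iff {AB : ℤ × ℤ} [Fact (Nat.Prime 5)]
    (h : IsInHeightFamily AB) :
    (shortWeierstrass (negB AB)).HasSplitMultiplicativeReductionAtPrime 5 ↔
      (shortWeierstrass AB).HasSplitMultiplicativeReductionAtPrime 5 := by
  have h' := (isInHeightFamily_negB AB).2 h
  rw [hasSplitMultiplicativeReductionAtPrime_five_shortWeierstrass_iff h'.1 (h'.2 5 Nat.prime_five),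
    hasSplitMultiplicativeReductionAtPrime_five_shortWeierstrass_iff h.1 (h.2 5 Nat.prime_five)]
  simp only [negB, Int.cast_neg, neg_eq_one_or_eq_four_iff]

/-- **A Tate parameter datum of `E_{A,-B}` at `5` is one of `E_{A,B}` with the same `q`** (the
datum is pinned by `j(q) = j(E)` and split multiplicative reduction, both even in `B`); so the
`𝓛`-invariants agree. [cite: MazurTateTeitelbaum1986Invent, §II.1] [cite: BhargavaSkinnerZhang2014, proof of Cor. 26 (p. 11)] -/
def tateParameterData_negB {AB : ℤ × ℤ} [Fact (Nat.Prime 5)] (h : IsInHeightFamily AB)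
    [(shortWeierstrass (negB AB)).IsElliptic] [(shortWeierstrass AB).IsElliptic]
    (D : TateParameterData (shortWeierstrass (negB AB)) 5) :
    TateParameterData (shortWeierstrass AB) 5 where
  q := D.q
  q_ne_zero := D.q_ne_zero
  norm_q_lt_one := D.norm_q_lt_one
  tateJ_eq := by
    rw [D.tateJ_eq]
    have hj := j_shortWeierstrass_negB h
    exact_mod_cast congrArg (fun x : ℚ ↦ (x : ℚ_[5])) hj
  split := (hasSplitMultiplicativeReductionAtPrime_five_negB_iff h).1 D.split

/-- The `𝓛`-invariant of the transported datum is the same element of `ℚ₅`. [cite: MazurTateTeitelbaum1986Invent, §II.1] -/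
theorem lInvariant_tateParameterData_negB {AB : ℤ × ℤ} [Fact (Nat.Prime 5)]
    (h : IsInHeightFamily AB) [(shortWeierstrass (negB AB)).IsElliptic]
    [(shortWeierstrass AB).IsElliptic] (D : TateParameterData (shortWeierstrass (negB AB)) 5) :
    LInvariant (tateParameterData_negB h D) = LInvariant D := rfl

/-- **`T = S₀(5) ∩ S₁'(5)` is stable under the twist by `-1`** on the height family — the
hypothesis `_hstab` of `thm16_exists_rootNumber_twist_subfamily_of_twistStable` for (any
congruence presentation of a truncation of) `T`, and the sentence "`S₁(5)` is stable under
`-1`-twist" of the proof of Cor. 26. [cite: BhargavaSkinnerZhang2014, proof of Cor. 26 (p0011 L84–85)] -/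
theorem S₁'.negB {AB : ℤ × ℤ} (hfam : IsInHeightFamily AB) (h : S₁' AB) : S₁' (negB AB) := by
  haveI : Fact (Nat.Prime 5) := ⟨Nat.prime_five⟩
  refine ⟨h.1.negB, ?_, ?_⟩
  · rw [disc_negB]; exact h.2.1
  · intro _ hsplit D
    haveI := isElliptic_shortWeierstrass hfam
    have hsplit' := (hasSplitMultiplicativeReductionAtPrime_five_negB_iff hfam).1 hsplit
    have := h.hL hsplit' (tateParameterData_negB hfam D)
    rwa [lInvariant_tateParameterData_negB] at this

/-- `T ∋ E_{A,-B} ↔ T ∋ E_{A,B}` on the height family (`negB` is an involution).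
[cite: BhargavaSkinnerZhang2014, proof of Cor. 26 (p0011 L84–85)] -/
theorem S₁'_negB_iff {AB : ℤ × ℤ} (hfam : IsInHeightFamily AB) : S₁' (negB AB) ↔ S₁' AB :=
  ⟨fun h ↦ by simpa only [negB_negB] using h.negB ((isInHeightFamily_negB AB).2 hfam),
    fun h ↦ h.negB hfam⟩

/-- `S₁ = S₁' ∩ S₁Cond` is stable under the twist by `-1` on the height family.
[cite: BhargavaSkinnerZhang2014, proof of Cor. 26 (p0011 L84–85)] -/
theorem S₁.negB {AB : ℤ × ℤ} (hfam : IsInHeightFamily AB) (h : S₁ AB) : S₁ (negB AB) :=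
  ⟨h.1.negB hfam, (S₁Cond_negB_iff AB).2 h.2⟩

/-- The truncation `T_K` is stable under the twist by `-1` on the height family.
[cite: BhargavaSkinnerZhang2014, proof of Cor. 26 (p0011 L84–85)] -/
theorem S₁'Trunc.negB {K : ℕ} {AB : ℤ × ℤ} (hfam : IsInHeightFamily AB) (h : S₁'Trunc K AB) :
    S₁'Trunc K (negB AB) :=
  ⟨h.1.negB hfam, by rw [disc_negB]; exact h.2⟩

/-! ### The local `5`-torsion clause under the twist by `-1`: `E_{A,-B} ≅ E_{A,B}` over `ℚ₅` -/

/-- `-1` is a square in `ℚ₅` (`-4 ≡ 1 (mod 5)` is a square in `ℤ₅` by Hensel — tree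
`padicInt_isSquare_of_toZMod_eq_one` — and `-1 = -4/2²`). [cite: Serre1973, Ch. II §3.3 Thm 3] -/
theorem exists_sq_eq_neg_one_padic_five : ∃ i : ℚ_[5], i ^ 2 = -1 := by
  have h4 : PadicInt.toZMod (-4 : ℤ_[5]) = 1 := by
    rw [map_neg, map_ofNat]; decide
  obtain ⟨z, hz⟩ :=
    Literature.NumberTheory.QuadraticForms.padicInt_isSquare_of_toZMod_eq_one (p := 5)
      (by norm_num) h4
  refine ⟨(z : ℚ_[5]) / 2, ?_⟩
  have hz' : ((z : ℚ_[5])) ^ 2 = -4 := by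
    have h := congrArg ((↑) : ℤ_[5] → ℚ_[5]) hz
    push_cast at h
    rw [sq]; exact h.symm
  rw [div_pow, hz']; norm_num

/-- **`E_{A,-B} ⊗ ℚ₅` is `E_{A,B} ⊗ ℚ₅` after the change of variables `(x, y) ↦ (-x, iy)`,
`i² = -1`** (`u = i`: `a₄ ↦ u⁻⁴a₄ = A`, `a₆ ↦ u⁻⁶a₆ = -B`; Silverman, *AEC*, III.1 Table 3.1) —
the quadratic twist by `-1` is trivial over `ℚ₅` since `5 ≡ 1 (mod 4)`.
[cite: SilvermanAEC2009, III.1 Table 3.1] [cite: BhargavaSkinnerZhang2014, Thm. 16 (§2.4, p. 6)] -/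
theorem smul_baseChange_shortWeierstrass_eq_negB (AB : ℤ × ℤ) {i : ℚ_[5]} (hi : i ^ 2 = -1)
    (hi0 : i ≠ 0) :
    (⟨Units.mk0 i hi0, 0, 0, 0⟩ : VariableChange ℚ_[5]) • (shortWeierstrass AB).baseChange ℚ_[5] =
      (shortWeierstrass (negB AB)).baseChange ℚ_[5] := by
  have h4 : i ^ 4 = 1 := by rw [show i ^ 4 = (i ^ 2) ^ 2 by ring, hi]; norm_num
  have h6 : i ^ 6 = -1 := by rw [show i ^ 6 = (i ^ 2) ^ 3 by ring, hi]; norm_num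
  have h4' : i⁻¹ ^ 4 = 1 := by rw [inv_pow, h4, inv_one]
  have h6' : i⁻¹ ^ 6 = -1 := by rw [inv_pow, h6, inv_neg, inv_one]
  ext <;> simp [WeierstrassCurve.variableChange_def, shortWeierstrass, negB,
    WeierstrassCurve.baseChange, WeierstrassCurve.map, h4', h6']

/-- For an isomorphism of abelian groups `e : G ≃+ H`, "`H[n] = 0`" iff "`G[n] = 0`" in the
spelling `∀ P, n • P = 0 → P = 0`. [folklore] -/
private theorem forall_nsmul_eq_zero_iff_addEquiv {G H : Type*} [AddCommGroup G] [AddCommGroup H]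
    (e : G ≃+ H) (n : ℕ) :
    (∀ Q : H, n • Q = 0 → Q = 0) ↔ (∀ P : G, n • P = 0 → P = 0) := by
  constructor
  · intro h P hP
    have hQ : e P = 0 := h (e P) (by rw [← map_nsmul, hP, map_zero])
    exact (EmbeddingLike.map_eq_zero_iff (f := e)).mp hQ
  · intro h Q hQ
    have hP : e.symm Q = 0 := h (e.symm Q) (by rw [← map_nsmul, hQ, map_zero])
    exact (EmbeddingLike.map_eq_zero_iff (f := e.symm)).mp hP

/-- **`E_{A,-B}(ℚ₅)[5] = 0 ↔ E_{A,B}(ℚ₅)[5] = 0`**: the two curves are isomorphic over `ℚ₅`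
(`smul_baseChange_shortWeierstrass_eq_negB`), and an admissible change of variables induces an
isomorphism of point groups (tree `VariableChange.pointEquiv`). [cite: SilvermanAEC2009, III.3.1(b)] -/
theorem locallyTorsionFree_negB_iff (AB : ℤ × ℤ) :
    LocallyTorsionFree (negB AB) ↔ LocallyTorsionFree AB := by
  obtain ⟨i, hi⟩ := exists_sq_eq_neg_one_padic_five
  have hi0 : i ≠ 0 := by
    rintro rfl
    norm_num at hi
  unfold LocallyTorsionFree
  rw [← smul_baseChange_shortWeierstrass_eq_negB AB hi hi0]
  exact forall_nsmul_eq_zero_iff_addEquiv (VariableChange.pointEquiv _ _) 5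

/-- **`R = T₅` is stable under the twist by `-1`** on the height family (`S₀`, `S₁'` and the local
`5`-torsion clause all are) — the hypothesis `_hstab` of
`thm16_exists_rootNumber_twist_subfamily_of_twistStable` for (any congruence presentation of a
truncation of) `R`. [cite: BhargavaSkinnerZhang2014, proof of Cor. 26 (pp. 11–12)] -/
theorem T₅_negB_iff {AB : ℤ × ℤ} (hfam : IsInHeightFamily AB) : T₅ (negB AB) ↔ T₅ AB := by
  simp only [T₅, S₀_negB_iff, S₁'_negB_iff hfam, locallyTorsionFree_negB_iff]

/-- `P = SP'_K` is stable under the twist by `-1` on the height family.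
[cite: BhargavaSkinnerZhang2014, proof of Cor. 26 (pp. 11–12)] -/
theorem SP'_negB_iff {K : ℕ} {AB : ℤ × ℤ} (hfam : IsInHeightFamily AB) :
    SP' K (negB AB) ↔ SP' K AB := by
  simp only [SP', S₀_negB_iff, S₁'_negB_iff hfam, locallyTorsionFree_negB_iff, disc_negB]

/-- The truncation `R_K` is stable under the twist by `-1` on the height family.
[cite: BhargavaSkinnerZhang2014, proof of Cor. 26 (pp. 11–12)] -/
theorem T₅Trunc_negB_iff {K : ℕ} {AB : ℤ × ℤ} (hfam : IsInHeightFamily AB) :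
    T₅Trunc K (negB AB) ↔ T₅Trunc K AB := by
  simp only [T₅Trunc, T₅_negB_iff hfam, disc_negB]

end Pieces

end Literature.NumberTheory.EllipticCurves.BhargavaSkinnerZhang2014

end
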